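/-
COR-CM (cell pub-hodgecm2) — Δ2 BRIDGE, T-SIGN TEST (coordinator 21:29Z), the INDEX-OF-RECORD route (disjoint from prove-6's F4-key route
`OmegaPinTSign.lean`): at the pinned dictionary of record the Hecke character of every continuous index line has CM type EQUAL TO the line's
type `(line i).lineType = Φ^δ(a_i)` — MIRROR — and at a GOOD line (`ι₁ ∈ (line i).lineType`) the conjugate embedding `ῑ₁` is NOT in `Φ_μ`.
Seat prover-pub-hodgecm2-d2bridge-prove-7-g0-0, 2026-08-23.  THEOREMS ONLY; nothing landed is edited or restated.  HC_CM is NOT proved;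
«Δ2 BRIDGE CLOSED» is NOT claimed.
-/
import Summits.HodgeConjecture.CorCM.B01.Transposition.Item6CentralTypeAtPinIndex
import Summits.HodgeConjecture.HodgeCM.Model.LiuDictionaryPinEq
import HarnessLib

/-!
# T-SIGN at the pinned dictionary of record: MIRROR (index route)

For `ρ := repAt a₀`, `μ₀ := muLiu ι₁ GramClass.rep`, under E's `hemb : (mk ι₁).embedding = ι₁`, X3-Char item (E) (✔ pin-3
`exists_weightOne_line_s_eq_chiSplittingLine_toHeckeCharacter`) gives, for every CONTINUOUS index line `i`, a conjugate-symplectic weight-one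
`μ` with `(line i).s = ι_{toHecke μ}` and `HasCMType μ (line i).lineType`; hence `hμ.cmType = (line i).lineType` (`IsConjugateSymplectic.cmType_eq`):
the rest of record `restOfCharDeltaPrime … μ hμ hw` built on it (Ω-pin keys, `CorCM/D2Bridge/OmegaPinAtLiuIndex[OfRecord]`) has
`R.isConjugateSymplectic.cmType = lineType (line i)` — the MIRROR alternative of the coordinator's dichotomy, not `(lineType (line i)).conj`.
At a GOOD line of the pinned dictionary (`T.PhiMu i = PhiMuLine ι₁ (line i) = ι₁ ∈ (line i).lineType`) this says `ι₁ ∈ Φ_μ`, so the conjugate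
embedding `ῑ₁ = conjugate ι₁` is NOT in `Φ_μ` (CM-type axiom).  Nothing here decides which of `ι₁ ∕ ῑ₁` is Liu's `τ′`; it records where the
family of record sits.  HC_CM is NOT proved.
-/

set_option autoImplicit false

noncomputable section

namespace HodgeCM.Model.LiuIndex.OmegaPin.TSign

open NumberField NumberField.InfinitePlace
open Literature.NumberTheory.Automorphic
open Literature.NumberTheory.Automorphic.IdeleClassGroup
open Literature.NumberTheory.Automorphic.Liu2021.Def411WeilCarriersDoubling
open Literature.NumberTheory.GelbartRogawski1991 Literature.NumberTheory.GelbartRogawski1991.UnitaryDualPair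
open Summit.HodgeConjecture.CorCM.Transposition.CentralTypeAtPin (exists_weightOne_line_s_eq_chiSplittingLine_toHeckeCharacter)
open HodgeCM.Model.ArchSideTerm (e₁)

variable {L : HodgeCM.CMField} {ι₁ : (L : Type) →+* ℂ} (V : HodgeCM.HermSpace3 L ι₁) (a₀ : RealScalar L)

/-- **T-SIGN = MIRROR at every continuous index line of the pinned dictionary of record**: its X3-Char character `μ` (the one the Ω-pin's
rest of record is built on) has `hμ.cmType = (line i).lineType` — EQUAL to the line's type, not to its conjugate.
[cite: Liu2021, Def. 4.1 ∕ 4.3, Def. 4.12 (FJcycle.tex l. 2102–2108), App. D §D.1 Step 2 (l. 5219)] -/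
theorem cmType_eq_lineType_indexOfRecord (hemb : (InfinitePlace.mk ι₁).embedding = ι₁)
    (i : I V (repAt a₀) (muLiu ι₁ GramClass.rep)) (hg : Continuous (i.2.1 : SplittingAt V (repAt a₀ i.1))) :
    ∃ (μ : Literature.NumberTheory.Automorphic.IdeleClassGroup (L : Type) →ₜ* Circle) (hμ : IsConjugateSymplectic (L : Type) μ),
      HasWeight (L : Type) μ 1 ∧ hμ.cmType = (line V (repAt a₀) (muLiu ι₁ GramClass.rep) i).lineType ∧
        (line V (repAt a₀) (muLiu ι₁ GramClass.rep) i).s =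
          chiSplittingLine (L : Type) e₁ (frameD V) (frameD_real V) (frameD_ne V) (toHeckeCharacter (L : Type) μ)
            (isUnitary_toHeckeCharacter (L : Type) μ) (isSplittingChar_toHeckeCharacter_of_isConjugateSymplectic (L : Type) μ hμ)
            (realDiagonal (L : Type) (RealScalar.vec (repAt a₀ i.1)) (RealScalar.vec_real (repAt a₀ i.1)))
            (isUnit_det_realDiagonal (L : Type) (RealScalar.vec (repAt a₀ i.1)) (RealScalar.vec_real (repAt a₀ i.1))
              (RealScalar.vec_ne (repAt a₀ i.1)))
            (Matrix.diagonal (RealScalar.vec (repAt a₀ i.1)))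
            (realDiagonal_map (L : Type) (RealScalar.vec (repAt a₀ i.1)) (RealScalar.vec_real (repAt a₀ i.1))).symm := by
  obtain ⟨μ, hμ, hw, hΦ, hs⟩ := exists_weightOne_line_s_eq_chiSplittingLine_toHeckeCharacter V (repAt a₀) GramClass.rep
    (fun q => repAt_spec a₀ q) GramClass.mk_rep hemb i hg
  exact ⟨μ, hμ, hw, hμ.cmType_eq hΦ, hs⟩

/-- **… and at a GOOD line `ῑ₁ ∉ Φ_μ`**: if `ι₁ ∈ (line i).lineType` (the pinned dictionary's `PhiMu i`), the X3-Char character `μ` of the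
line has `ι₁ ∈ Φ_μ` and `conjugate ι₁ ∉ Φ_μ` — the family of record is keyed at `ι₁`; Liu's `τ′ ∈ Φ_μ` read at `τ′ := ῑ₁` FAILS for it.
[cite: Liu2021, Def. 4.12 (FJcycle.tex l. 2102–2108), Thm. 4.18 (l. 2232–2237)] -/
theorem mem_cmType_and_conjugate_not_mem_indexOfRecord (hemb : (InfinitePlace.mk ι₁).embedding = ι₁)
    (i : I V (repAt a₀) (muLiu ι₁ GramClass.rep)) (hi : SplitLine.PhiMuLine ι₁ (line V (repAt a₀) (muLiu ι₁ GramClass.rep) i))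
    (hg : Continuous (i.2.1 : SplittingAt V (repAt a₀ i.1))) :
    ∃ (μ : Literature.NumberTheory.Automorphic.IdeleClassGroup (L : Type) →ₜ* Circle) (hμ : IsConjugateSymplectic (L : Type) μ),
      HasWeight (L : Type) μ 1 ∧
        (line V (repAt a₀) (muLiu ι₁ GramClass.rep) i).s =
          chiSplittingLine (L : Type) e₁ (frameD V) (frameD_real V) (frameD_ne V) (toHeckeCharacter (L : Type) μ)
            (isUnitary_toHeckeCharacter (L : Type) μ) (isSplittingChar_toHeckeCharacter_of_isConjugateSymplectic (L : Type) μ hμ)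
            (realDiagonal (L : Type) (RealScalar.vec (repAt a₀ i.1)) (RealScalar.vec_real (repAt a₀ i.1)))
            (isUnit_det_realDiagonal (L : Type) (RealScalar.vec (repAt a₀ i.1)) (RealScalar.vec_real (repAt a₀ i.1))
              (RealScalar.vec_ne (repAt a₀ i.1)))
            (Matrix.diagonal (RealScalar.vec (repAt a₀ i.1)))
            (realDiagonal_map (L : Type) (RealScalar.vec (repAt a₀ i.1)) (RealScalar.vec_real (repAt a₀ i.1))).symm ∧
        ι₁ ∈ hμ.cmType.1 ∧ NumberField.ComplexEmbedding.conjugate ι₁ ∉ hμ.cmType.1 := by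
  obtain ⟨μ, hμ, hw, hT, hs⟩ := cmType_eq_lineType_indexOfRecord V a₀ hemb i hg
  refine ⟨μ, hμ, hw, hs, ?_, ?_⟩
  · rw [hT]; exact hi
  · rw [hT]; exact ((line V (repAt a₀) (muLiu ι₁ GramClass.rep) i).lineType.2 ι₁).1 hi

end HodgeCM.Model.LiuIndex.OmegaPin.TSign

end
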